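import Summits.Schanuel.Schanuel.Theorems.DiophantineDichotomyKhovanskiiApproxTypeEvIffStubs
import Summits.Schanuel.Schanuel.Theorems.DiophantineDichotomyKhovanskiiApproxTypeEvFlagship
import HarnessLib

/-!
# Route `DiophantineDichotomy`, crux `KhovanskiiApproxTypeEv` (stmt-Schanuel-14972):
# the non-LW rank-2 layer at the Nesterenko point `(π, iπ)` — a LINEAR-in-`log H` simultaneous
# approximation measure for `(π, e^π)` (the "sum versus product of the heights" problem)

Crux `Summit.Schanuel.Schanuel.Theses.DiophantineDichotomy.KhovanskiiApproxTypeEv`, line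
`anchored-reduction` (skeleton `Cruxes/KhovanskiiApproxTypeEv/Lines/Sketch.lean`, registered stubs
`stub_evNonLW_two : EvNonLWTwo`, `stub_evRankThreeUp : EvRankThreeUp`), lead c7.  Hardness certificate
of the registered stub `stub_evNonLW_two` (= leaf `NonLWLayerRankTwo` of the strategist's split,
`Cruxes/KhovanskiiApproxTypeEv/Split.lean`, §T2 of `STRATEGY-CENSUS.md`) at the free Khovanskii point
`s = (π, iπ)`: system `y₁ + 1 = 0`, `x₀² + x₁² = 0`, exponential Jacobian `((0, −1), (2π, 2πi))` of
determinant `2π ≠ 0`; `θ = (π, iπ, e^π, −1)`.  Here the transcendence degree is KNOWN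
(`trdeg_ℚ ℚ(π, e^π) = 2`, Nesterenko 1996), so the level-one race certifies nothing open; what the stub
asserts at this point is a DIOPHANTINE statement:

* `piExpPi_simultaneousTypeEv_of_evAt` — an eventual approximation type `(a, b, C₀)`, `a < 1`, at
  `(π, iπ)` gives, for the PAIR `(π, e^π)`: `∃ a < 1, b, C > 0, ∀ d ∃ H₀ ∀ H ≥ H₀`, every algebraic
  `(γ₁, γ₂)` with `[ℚ(γ₁, γ₂):ℚ] ≤ d` whose coordinates are roots of non-zero integer polynomials of
  degree `≤ d` and height `≤ H` satisfies `max(|γ₁ − π|, |γ₂ − e^π|) ≥ exp(−C(dᵃ log H + dᵇ))` — lift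
  `(γ₁, γ₂) ↦ (γ₁, iγ₁, γ₂, −1)` at level `(2d, (2d+1)H²)` (the landed lift machinery of
  `Theorems/EPiSimultaneousType/Negative/{LiftClause,OfKhovanskiiApproxType}.lean`);
* `piExpPi_simultaneousTypeEv_of_evNonLWTwo : EvNonLWTwo → (that measure)` (registered sub-goal) and
  `piExpPi_simultaneousTypeEv_of_khovanskiiApproxTypeEv` (the crux as filed, via `evNonLWTwo_of_ev`).

The measure is LINEAR in `log H` at fixed degree (any ineffective threshold `H₀(d)` allowed).  The
printed simultaneous measures for `(π, e^π)` are not: Nesterenko–Waldschmidt 1996, Main Theorem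
(`|e^θ − α| + |θ − β| ≥ exp(−211·D·(log B + log log A + …)(D log A + …)(…)(log E)^{−2})`, the PRODUCT
of the logarithms of the two heights, i.e. quadratic in `log H`), Nesterenko–Philippon 2001 Ch. 3
Cor. 5.2 (`(log H)⁴ (log log H)²⁴` at fixed degree); replacing the product of the heights by their
sum is the open problem singled out in Waldschmidt 2004 §2 ("no proof so far that `e^π` is not a
Liouville number").  So inside leaf 2 this is the cheapest genuinely open sub-target: NOT a
transcendence-degree statement (no catalogued transcendence barrier applies), but beyond print.
All implications are UNCONDITIONAL; nothing is credited to the summit; no `def`; sorry-free;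
axioms standard.
-/

noncomputable section

-- `Summit.Schanuel.Schanuel.…` is the mandated summit/sub-problem namespace (single-conjunct summit), hence:
set_option linter.dupNamespace false

namespace Summit.Schanuel.Schanuel.Cruxes.KhovanskiiApproxTypeEv.AnchoredReduction

open Summit.Schanuel.Schanuel.Theses.DiophantineDichotomy (KhovanskiiApproxTypeEv)
open Summit.Schanuel.Schanuel.Cruxes.KhovanskiiApproxType.LwSmallHeight (IsFreeKhovanskii)
open Summit.Schanuel.Schanuel.Theorems
open Polynomial Complex
open scoped IntermediateField

/-! ## The Nesterenko point `s = (π, iπ)` -/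

/-- `π, iπ` are `ℚ`-linearly independent (`π ≠ 0` and `i ∉ ℚ`). [folklore] -/
theorem linearIndependent_pi_I_pi : LinearIndependent ℚ ![(Real.pi : ℂ), I * Real.pi] := by
  rw [LinearIndependent.pair_iff]
  intro s t hst
  have hπ : (Real.pi : ℂ) ≠ 0 := Complex.ofReal_ne_zero.mpr Real.pi_ne_zero
  rw [Rat.smul_def, Rat.smul_def] at hst
  have h : ((s : ℂ) + (t : ℂ) * I) * (Real.pi : ℂ) = 0 := by
    linear_combination hst
  have h2 : (s : ℂ) + (t : ℂ) * I = 0 := (mul_eq_zero.mp h).resolve_right hπ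
  have h3 := congrArg Complex.re h2
  have h4 := congrArg Complex.im h2
  simp at h3 h4
  exact ⟨by exact_mod_cast h3, by exact_mod_cast h4⟩

/-- `e^{iπ} = −1`, in the form `cexp (I * π)`. [folklore] -/
theorem cexp_I_mul_pi : cexp (I * Real.pi) = -1 := by
  rw [mul_comm]; exact Complex.exp_pi_mul_I

/-- `s = (π, iπ)` is a free Khovanskii point of rank `2`: a zero of the Khovanskii system
`y₁ + 1 = 0`, `x₀·x₀ + x₁·x₁ = 0` (i.e. `e^{s₁} = −1`, `s₀² + s₁² = 0`) whose exponential Jacobian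
`(∂g_i/∂x_j + y_j ∂g_i/∂y_j) = ((0, e^{iπ}), (2π, 2πi)) = ((0, −1), (2π, 2πi))` has determinant
`2π ≠ 0`.  (At this point `trdeg_ℚ ℚ(s, e^s) = trdeg_ℚ ℚ(π, e^π) = 2` is Nesterenko's theorem.)
[folklore] -/
theorem isFreeKhovanskii_pi_I_pi : IsFreeKhovanskii 2 ![(Real.pi : ℂ), I * Real.pi] := by
  classical
  refine ⟨![MvPolynomial.X (Sum.inr 1) + MvPolynomial.C 1,
    MvPolynomial.X (Sum.inl 0) * MvPolynomial.X (Sum.inl 0) +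
      MvPolynomial.X (Sum.inl 1) * MvPolynomial.X (Sum.inl 1)], ?_, ?_⟩
  · intro i
    fin_cases i
    · simp [cexp_I_mul_pi]
    · simp only [Fin.mk_one, Fin.isValue, Matrix.cons_val_one, Matrix.cons_val_fin_one, map_add,
        map_mul, MvPolynomial.aeval_X, Sum.elim_inl, Matrix.cons_val_zero]
      ring_nf
      rw [Complex.I_sq]
      ring
  · rw [Matrix.det_fin_two]
    have hπ : (Real.pi : ℂ) ≠ 0 := Complex.ofReal_ne_zero.mpr Real.pi_ne_zero
    simp [Matrix.of_apply, MvPolynomial.pderiv_X, cexp_I_mul_pi, hπ]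

/-! ## The lift `(γ₁, γ₂) ↦ (γ₁, iγ₁, γ₂, −1)` -/

/-- FIELD DEGREE OF THE LIFT: `[ℚ(γ₁, iγ₁, γ₂, −1):ℚ] ≤ 2·[ℚ(γ₁, γ₂):ℚ]` when `γ₁, γ₂` are algebraic
(compositum with `ℚ(i)`; pattern of `EPiSimultaneousType.finrank_lift_le`). [folklore] -/
theorem finrank_lift_pi_le (γ : Fin 2 → ℂ) (hint : ∀ i, IsIntegral ℚ (γ i)) :
    Module.finrank ℚ ↥(IntermediateField.adjoin ℚ
        (Set.range (Sum.elim ![γ 0, I * γ 0] ![γ 1, -1] : Fin 2 ⊕ Fin 2 → ℂ))) ≤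
      2 * Module.finrank ℚ ↥(IntermediateField.adjoin ℚ (Set.range γ)) := by
  set K1 := IntermediateField.adjoin ℚ (Set.range γ) with hK1
  set K2 : IntermediateField ℚ ℂ := ℚ⟮I⟯ with hK2
  haveI : Finite (Set.range γ) := Set.finite_range γ |>.to_subtype
  haveI : FiniteDimensional ℚ K1 :=
    IntermediateField.finiteDimensional_adjoin (fun x hx => by
      obtain ⟨i, rfl⟩ := hx; exact hint i)
  haveI : FiniteDimensional ℚ K2 :=
    IntermediateField.adjoin.finiteDimensional EPiSimultaneousType.isIntegral_I
  have hle : IntermediateField.adjoin ℚ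
      (Set.range (Sum.elim ![γ 0, I * γ 0] ![γ 1, -1] : Fin 2 ⊕ Fin 2 → ℂ)) ≤ K1 ⊔ K2 := by
    rw [IntermediateField.adjoin_le_iff]
    rintro _ ⟨i, rfl⟩
    have hγ : ∀ j, γ j ∈ K1 ⊔ K2 := fun j =>
      (le_sup_left : K1 ≤ K1 ⊔ K2) (IntermediateField.subset_adjoin ℚ _ ⟨j, rfl⟩)
    have hI : I ∈ K1 ⊔ K2 :=
      (le_sup_right : K2 ≤ K1 ⊔ K2) (IntermediateField.mem_adjoin_simple_self ℚ I)
    rcases i with i | i <;> fin_cases i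
    · exact hγ 0
    · exact mul_mem hI (hγ 0)
    · exact hγ 1
    · exact neg_mem (one_mem _)
  calc Module.finrank ℚ ↥(IntermediateField.adjoin ℚ
          (Set.range (Sum.elim ![γ 0, I * γ 0] ![γ 1, -1] : Fin 2 ⊕ Fin 2 → ℂ)))
      ≤ Module.finrank ℚ ↥(K1 ⊔ K2) := IntermediateField.finrank_le_of_le_right hle
    _ ≤ Module.finrank ℚ K1 * Module.finrank ℚ K2 := IntermediateField.finrank_sup_le K1 K2
    _ ≤ Module.finrank ℚ K1 * 2 := Nat.mul_le_mul_left _ EPiSimultaneousType.finrank_adjoin_I_le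
    _ = 2 * Module.finrank ℚ K1 := by ring

/-! ## The measure for the pair `(π, e^π)` -/

/-- **An eventual approximation type `a < 1` at the Nesterenko point `(π, iπ)` is a LINEAR-in-`log H`
simultaneous approximation measure for the pair `(π, e^π)`.**  Lift the challenger
`(γ₁, γ₂) ↦ (γ₁, iγ₁, γ₂, −1)` (level `(d, H) ↦ (2d, (2d+1)H²)`, `EPiSimultaneousType.clause_I_mul`),
apply the measure at `θ = (π, iπ, e^π, −1)`, and transfer the constants
(`EPiSimultaneousType.transfer_constants`): exponent `a` unchanged, `b ↦ max(a+1, b)`,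
`C ↦ C₀(2^{|a|+1} + 2^{|b|})`, threshold `H₀(d) := H₀'(2d)`.  The printed measures for this pair
carry the PRODUCT of the logarithms of the two heights (Nesterenko–Waldschmidt 1996, Main Theorem),
not the sum. [cite: NesterenkoWaldschmidt1996, Main Theorem p. 1] -/
theorem piExpPi_simultaneousTypeEv_of_evAt {a b C0 : ℝ} (ha : a < 1)
    (hM : ApproxTypeEvAt 2 ![(Real.pi : ℂ), I * Real.pi] a b C0) :
    ∃ a b C : ℝ, a < 1 ∧ 0 < C ∧ ∀ d : ℕ, ∃ H₀ : ℕ, ∀ (H : ℕ) (γ : Fin 2 → ℂ), H₀ ≤ H →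
      Module.finrank ℚ ↥(IntermediateField.adjoin ℚ (Set.range γ)) ≤ d →
      (∀ i, ∃ P : Polynomial ℤ, P ≠ 0 ∧ P.natDegree ≤ d ∧ (∀ k, |P.coeff k| ≤ (H : ℤ)) ∧
        Polynomial.aeval (γ i) P = 0) →
      Real.exp (-(C * ((d : ℝ) ^ a * Real.log H + (d : ℝ) ^ b))) ≤
        ‖γ - ![(Real.pi : ℂ), (Real.exp Real.pi : ℂ)]‖ := by
  obtain ⟨hC, hM⟩ := hM
  choose H₀ hH₀ using hM
  refine ⟨a, max (a + 1) b, C0 * (2 ^ (|a| + 1) + 2 ^ |b|), ha, by positivity, fun d => ⟨H₀ (2 * d), ?_⟩⟩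
  intro H γ hH hfin hcl
  obtain ⟨hd1, hH1⟩ := EPiSimultaneousType.one_le_of_clause' (hcl 0)
  obtain ⟨hH', h1''⟩ := EPiSimultaneousType.height_lift_le (d := d) hH1
  -- the lifted challenger
  set γ4 : Fin 2 ⊕ Fin 2 → ℂ := Sum.elim ![γ 0, I * γ 0] ![γ 1, -1] with hγ4
  have hfin4 : Module.finrank ℚ ↥(IntermediateField.adjoin ℚ (Set.range γ4)) ≤ 2 * d :=
    (finrank_lift_pi_le γ
      (fun i => EPiSimultaneousType.isIntegral_of_clause (hcl i))).trans (Nat.mul_le_mul_left 2 hfin)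
  have hcl4 : ∀ i, ∃ P : Polynomial ℤ, P ≠ 0 ∧ P.natDegree ≤ 2 * d ∧
      (∀ k, |P.coeff k| ≤ (((2 * d + 1) * H ^ 2 : ℕ) : ℤ)) ∧ Polynomial.aeval (γ4 i) P = 0 := by
    rintro (i | i) <;> fin_cases i
    · obtain ⟨P, hP0, hdeg, hHt, hroot⟩ := hcl 0
      exact ⟨P, hP0, by omega, fun k => (hHt k).trans hH', by simpa [hγ4] using hroot⟩
    · simpa [hγ4] using EPiSimultaneousType.clause_I_mul (hcl 0)
    · obtain ⟨P, hP0, hdeg, hHt, hroot⟩ := hcl 1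
      exact ⟨P, hP0, by omega, fun k => (hHt k).trans hH', by simpa [hγ4] using hroot⟩
    · refine ⟨X + C 1, X_add_C_ne_zero 1, by rw [natDegree_X_add_C]; omega, fun k => ?_, by simp [hγ4]⟩
      rw [coeff_add, coeff_X, coeff_C]
      rcases k with _ | _ | k
      · simpa using h1''
      · simpa using h1''
      · simp
  have hthr : H₀ (2 * d) ≤ (2 * d + 1) * H ^ 2 := by
    have h1 : H ≤ (2 * d + 1) * H ^ 2 := by exact_mod_cast hH'
    exact hH.trans h1
  have hmeas := hH₀ (2 * d) ((2 * d + 1) * H ^ 2) γ4 hthr hfin4 hcl4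
  have hdist : ‖γ4 - Sum.elim ![(Real.pi : ℂ), I * Real.pi]
      (Complex.exp ∘ ![(Real.pi : ℂ), I * Real.pi])‖ ≤
      ‖γ - ![(Real.pi : ℂ), (Real.exp Real.pi : ℂ)]‖ := by
    rw [pi_norm_le_iff_of_nonneg (norm_nonneg _)]
    rintro (i | i) <;> fin_cases i
    · have := norm_le_pi_norm (γ - ![(Real.pi : ℂ), (Real.exp Real.pi : ℂ)]) 0
      simpa [hγ4] using this
    · have := norm_le_pi_norm (γ - ![(Real.pi : ℂ), (Real.exp Real.pi : ℂ)]) 0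
      simpa [hγ4, ← mul_sub, norm_mul] using this
    · have := norm_le_pi_norm (γ - ![(Real.pi : ℂ), (Real.exp Real.pi : ℂ)]) 1
      simpa [hγ4, Complex.ofReal_exp] using this
    · simp [hγ4, cexp_I_mul_pi]
  refine le_trans ?_ (hmeas.trans hdist)
  rw [Real.exp_le_exp, neg_le_neg_iff]
  exact EPiSimultaneousType.transfer_constants hC.le hd1 hH1

/-- **Registered sub-goal `piExpPi_simultaneousTypeEv_of_evNonLWTwo` — stub 6 asserts, at the
Nesterenko point, a linear-in-`log H` simultaneous approximation measure for `(π, e^π)`.**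
`EvNonLWTwo` (eventual type `a < 1` at every free Khovanskii point of `ℂ²` with a transcendental
coordinate) applies at `(π, iπ)` (`isFreeKhovanskii_pi_I_pi`; `iπ` transcendental by
Hermite–Lindemann, PROVED in the tree), and `piExpPi_simultaneousTypeEv_of_evAt` gives the measure.
Printed: only the product-of-heights measure (Nesterenko–Waldschmidt 1996); the sum form is the open
problem of Waldschmidt 2004 §2 ("no proof so far that `e^π` is not a Liouville number").
[cite: Waldschmidt2004, §2] -/
theorem piExpPi_simultaneousTypeEv_of_evNonLWTwo : EvNonLWTwo →
    ∃ a b C : ℝ, a < 1 ∧ 0 < C ∧ ∀ d : ℕ, ∃ H₀ : ℕ, ∀ (H : ℕ) (γ : Fin 2 → ℂ), H₀ ≤ H →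
      Module.finrank ℚ ↥(IntermediateField.adjoin ℚ (Set.range γ)) ≤ d →
      (∀ i, ∃ P : Polynomial ℤ, P ≠ 0 ∧ P.natDegree ≤ d ∧ (∀ k, |P.coeff k| ≤ (H : ℤ)) ∧
        Polynomial.aeval (γ i) P = 0) →
      Real.exp (-(C * ((d : ℝ) ^ a * Real.log H + (d : ℝ) ^ b))) ≤
        ‖γ - ![(Real.pi : ℂ), (Real.exp Real.pi : ℂ)]‖ := by
  intro hN
  have htr : ∃ i, Transcendental ℚ (![(Real.pi : ℂ), I * Real.pi] i) :=
    ⟨1, by simpa [mul_comm] using Literature.NumberTheory.Transcendental.transcendental_pi_mul_I⟩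
  obtain ⟨a, b, C, ha, hM⟩ := hN ![(Real.pi : ℂ), I * Real.pi] linearIndependent_pi_I_pi
    isFreeKhovanskii_pi_I_pi htr
  exact piExpPi_simultaneousTypeEv_of_evAt ha hM

/-- **The crux as filed asserts the same linear-in-`log H` measure for `(π, e^π)`** (instance `n = 2`,
`s = (π, iπ)`, through `evNonLWTwo_of_ev`, p125111). [cite: Waldschmidt2004, §2] -/
theorem piExpPi_simultaneousTypeEv_of_khovanskiiApproxTypeEv (hEv : KhovanskiiApproxTypeEv) :
    ∃ a b C : ℝ, a < 1 ∧ 0 < C ∧ ∀ d : ℕ, ∃ H₀ : ℕ, ∀ (H : ℕ) (γ : Fin 2 → ℂ), H₀ ≤ H →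
      Module.finrank ℚ ↥(IntermediateField.adjoin ℚ (Set.range γ)) ≤ d →
      (∀ i, ∃ P : Polynomial ℤ, P ≠ 0 ∧ P.natDegree ≤ d ∧ (∀ k, |P.coeff k| ≤ (H : ℤ)) ∧
        Polynomial.aeval (γ i) P = 0) →
      Real.exp (-(C * ((d : ℝ) ^ a * Real.log H + (d : ℝ) ^ b))) ≤
        ‖γ - ![(Real.pi : ℂ), (Real.exp Real.pi : ℂ)]‖ :=
  piExpPi_simultaneousTypeEv_of_evNonLWTwo (evNonLWTwo_of_ev hEv)

end Summit.Schanuel.Schanuel.Cruxes.KhovanskiiApproxTypeEv.AnchoredReduction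

end
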